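import Summits.RiemannHypothesis.RiemannHypothesis.Theorems.JensenLogBandFarZoneCompetitorXi
import HarnessLib

/-!
# The in-strip flank of the own arc (BAND crux, [FL-strip], regime R2)

RH ladder column JENSEN, rung J-P(P3) «log band», BAND crux `XiDerivBandRealAllRates`
(stmt-RiemannHypothesis-19913) of route «JensenLogBand», line «band-one-window» (top-shell reshape,
BAND lead rh-jensen-prover g8) — input for the lead's flank bound [FL] in regime R2. RH-FREE.
WHAT THIS IS NOT: nothing here bears on zeros of `ζ` or the truth of RH.

On the own saddle circle `u_θ = c + r e^{iθ}` (`c = x + iT`, `r = ‖u* − c‖`), the part of the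
flank with abscissa `½ + x + r cos θ ≤ 1 + δ` lies in the closed strip, where `|ζ|` has only the
convexity bound; the sharp descent F6 alone does not make it negligible. But there the flat
majorant F2 bounds `ξ = γ̃ζ` directly, and comparing `γ̃(1+δ+iT)` with `γ̃(½+u*)` (F7c) GIVES the
descent, with no Laplace geometry:

* `norm_xiSq_sq_arc_le_of_re_le` — pointwise F7a: `‖ξ(½+u_θ)‖ ≤ 672·log(T+ρ)·e^{(4/5)ρ}·‖γ̃(1+δ+iT)‖`
  for an arc point of radius `0 < ρ ≤ 28` with `½ + x' + ρ cos θ ≤ 1 + δ` (`|θ| ≤ π/2`, `T ≥ 1200`);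
* **`norm_arcIntegrandU_saddleArc_le_of_re_le`**: in regime R2 (`h ≤ 20`), for `|θ| ≤ π/2` with
  `½ + x + r cos θ ≤ 1 + δ ≤ σ* = Re(½+u*)` (`0 < δ ≤ 1`):
  `‖arcIntegrandU n r c θ‖ ≤ 672·log(T + r)·e^{2h+1}·exp(−(σ* − 1 − δ)(ℓ_T/2 − 1))·‖I_r(φ₀)‖`.
  So [FL] = (arc right of `1+δ`: F6c × `|ζ| ≤ 1 + 1/δ`) + (arc left of `1+δ`: this lemma); in the
  top shell `σ* − 1 − δ = (h − ½ + x) − δ − ε`, positive for the own centre because `h > 4/c > ½`.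

(prover-rh-jensen-eng-2-g6-0, 2026-08-27.)
-/

noncomputable section

-- single-problem summit: `Summit.RiemannHypothesis.RiemannHypothesis.…` is the tree convention
set_option linter.dupNamespace false

open Complex Real Set

namespace Summit.RiemannHypothesis.RiemannHypothesis.Theorems.JensenPolynomials.LogBandArc

open Literature.NumberTheory.LFunctions

variable {n : ℕ} {x T : ℝ} {u : ℂ}

/-- **`ξ` at an arc point inside the strip (pointwise F7a):** for `|x'| ≤ ½`, `0 < ρ ≤ 28`,
`T ≥ 1200`, `0 < δ ≤ 1`, `|θ| ≤ π/2` and `½ + x' + ρ cos θ ≤ 1 + δ`, with `u_θ = (x'+iT) + ρ e^{iθ}`: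
`‖ξ(½ + u_θ)‖ ≤ 672·log(T + ρ)·e^{(4/5)ρ}·‖γ̃((1+δ) + iT)‖`. RH-FREE. [folklore] -/
theorem norm_xiSq_sq_arc_le_of_re_le {x' ρ T δ θ : ℝ} (hx' : |x'| ≤ 1 / 2) (hρ0 : 0 < ρ)
    (hρ : ρ ≤ 28) (hT : 1200 ≤ T) (hδ : 0 < δ) (hδ1 : δ ≤ 1)
    (hθ : |θ| ≤ Real.pi / 2) (hleft : 1 / 2 + x' + ρ * Real.cos θ ≤ 1 + δ) :
    ‖xiSq ((circleMap ((x' : ℂ) + (T : ℂ) * I) ρ θ) ^ 2)‖ ≤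
      672 * Real.log (T + ρ) * Real.exp (4 / 5 * ρ) *
        ‖xiGammaFactor (((1 + δ : ℝ) : ℂ) + (T : ℂ) * I)‖ := by
  rw [xiSq_sq]
  set s : ℂ := 1 / 2 + circleMap ((x' : ℂ) + (T : ℂ) * I) ρ θ with hs
  have hcoord := half_add_circleMap_eq x' T ρ θ
  have hsre : s.re = 1 / 2 + x' + ρ * Real.cos θ := by
    rw [hs, hcoord]
    simp only [Complex.add_re, Complex.ofReal_re, Complex.mul_re, Complex.I_re, Complex.I_im,
      Complex.ofReal_im]
    ring
  have hsim : s.im = T + ρ * Real.sin θ := by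
    rw [hs, hcoord]
    simp only [Complex.add_im, Complex.ofReal_im, Complex.mul_im, Complex.I_re, Complex.I_im,
      Complex.ofReal_re]
    ring
  have hx'' := abs_le.1 hx'
  have hcos0 : 0 ≤ Real.cos θ := Real.cos_nonneg_of_mem_Icc (abs_le.1 hθ)
  have hsin := abs_le.1 (Real.abs_sin_le_one θ)
  have hρc : 0 ≤ ρ * Real.cos θ := mul_nonneg hρ0.le hcos0
  have hρs : ρ * (-1) ≤ ρ * Real.sin θ := mul_le_mul_of_nonneg_left hsin.1 hρ0.le
  have hρs' : ρ * Real.sin θ ≤ ρ * 1 := mul_le_mul_of_nonneg_left hsin.2 hρ0.le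
  have h0 : 0 ≤ s.re := by rw [hsre]; linarith only [hx''.1, hρc]
  have h1 : s.re ≤ 1 + δ := by rw [hsre]; exact hleft
  have him12 : 12 ≤ s.im := by rw [hsim]; linarith only [hρs, hT, hρ]
  have him_lo : T - ρ ≤ s.im := by rw [hsim]; linarith only [hρs]
  have him_hi : s.im ≤ T + ρ := by rw [hsim]; linarith only [hρs']
  have hmaj := norm_riemannXi_le_strip_majorant' h0 h1 hδ hδ1 him12
  have hlog : Real.log s.im ≤ Real.log (T + ρ) := Real.log_le_log (by linarith) him_hi
  have hvert := norm_xiGammaFactor_vertical_le_symm (σ := 1 + δ) (t := T) (t' := s.im) (t₀ := T - ρ)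
    (by linarith) (by linarith) (by linarith) him_lo
  have hdt : |s.im - T| ≤ ρ := by
    rw [hsim, show T + ρ * Real.sin θ - T = ρ * Real.sin θ by ring, abs_mul, abs_of_pos hρ0]
    exact mul_le_of_le_one_right hρ0.le (Real.abs_sin_le_one θ)
  have hrate : (π / 4 + 6 / (T - ρ)) * |s.im - T| ≤ 4 / 5 * ρ := by
    have h6 : 6 / (T - ρ) ≤ 1 / 100 := by
      rw [div_le_iff₀ (by linarith)]; linarith
    have hr0 : 0 ≤ π / 4 + 6 / (T - ρ) := by
      have : 0 ≤ 6 / (T - ρ) := div_nonneg (by norm_num) (by linarith)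
      linarith only [this, Real.pi_pos]
    calc (π / 4 + 6 / (T - ρ)) * |s.im - T| ≤ (π / 4 + 6 / (T - ρ)) * ρ :=
          mul_le_mul_of_nonneg_left hdt hr0
      _ ≤ 4 / 5 * ρ := by
          apply mul_le_mul_of_nonneg_right _ hρ0.le
          linarith only [Real.pi_lt_d2, h6]
  have hG : ‖xiGammaFactor (((1 + δ : ℝ) : ℂ) + (s.im : ℂ) * I)‖ ≤
      ‖xiGammaFactor (((1 + δ : ℝ) : ℂ) + (T : ℂ) * I)‖ * Real.exp (4 / 5 * ρ) :=
    hvert.trans (mul_le_mul_of_nonneg_left (Real.exp_le_exp.2 hrate) (norm_nonneg _))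
  calc ‖riemannXi s‖ ≤ 672 * Real.log s.im * ‖xiGammaFactor (((1 + δ : ℝ) : ℂ) + (s.im : ℂ) * I)‖ := hmaj
    _ ≤ 672 * Real.log (T + ρ) *
        (‖xiGammaFactor (((1 + δ : ℝ) : ℂ) + (T : ℂ) * I)‖ * Real.exp (4 / 5 * ρ)) :=
        mul_le_mul (by linarith only [hlog]) hG (norm_nonneg _)
          (mul_nonneg (by norm_num) (Real.log_nonneg (by linarith)))
    _ = 672 * Real.log (T + ρ) * Real.exp (4 / 5 * ρ) *
        ‖xiGammaFactor (((1 + δ : ℝ) : ℂ) + (T : ℂ) * I)‖ := by ring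

/-- **[FL-strip] — the own arc's flank inside the strip.** Regime R2 (`h = h(n,T) ≤ 20`) at the own
centre `c = x + iT`, `u*` the saddle, `r = ‖u* − c‖`, `φ₀ = arg(u* − c)`, `σ* = Re(½ + u*)`.
For `|θ| ≤ π/2` with `½ + x + r cos θ ≤ 1 + δ` and `1 + δ ≤ σ*` (`0 < δ ≤ 1`):
`‖arcIntegrandU n r c θ‖ ≤ 672·log(T + r)·e^{2h+1}·exp(−(σ* − 1 − δ)(ℓ_T/2 − 1))·‖I_r(φ₀)‖`.
RH-FREE. [folklore] -/
theorem norm_arcIntegrandU_saddleArc_le_of_re_le {δ : ℝ} (hx : |x| ≤ 1 / 2) (hT : 100 ≤ T)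
    (hℓ : 20 ≤ ell T) (hn : 100 ≤ n) (hh : 1 / 2 ≤ bandRadius n T)
    (hhT : bandRadius n T ≤ 7 / 20 * T) (hH : bandRadius n T ≤ 20)
    (hu : ‖u - ((x : ℂ) + (T : ℂ) * I + bandRadius n T)‖ ≤ 3 / 5 * bandRadius n T)
    (hS : arcSaddleFn n ((x : ℂ) + (T : ℂ) * I) u = 0) (hδ : 0 < δ) (hδ1 : δ ≤ 1)
    (hδσ : 1 + δ ≤ (1 / 2 + u).re) {θ : ℝ} (hθ : |θ| ≤ Real.pi / 2)
    (hleft : 1 / 2 + x + ‖u - ((x : ℂ) + (T : ℂ) * I)‖ * Real.cos θ ≤ 1 + δ) :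
    ‖arcIntegrandU n ‖u - ((x : ℂ) + (T : ℂ) * I)‖ ((x : ℂ) + (T : ℂ) * I) θ‖ ≤
      672 * Real.log (T + ‖u - ((x : ℂ) + (T : ℂ) * I)‖) * Real.exp (2 * bandRadius n T + 1) *
        Real.exp (-(((1 / 2 + u).re - (1 + δ)) * (ell T / 2 - 1))) *
        ‖arcModelIntegrand n ‖u - ((x : ℂ) + (T : ℂ) * I)‖ ((x : ℂ) + (T : ℂ) * I)
          (Complex.arg (u - ((x : ℂ) + (T : ℂ) * I)))‖ := by
  obtain ⟨-, hεh, hε33, hT1200, -⟩ := R2_bookkeeping hT hℓ hh hH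
  obtain ⟨-, -, hr_lo, hr_hi⟩ := arcSaddle_sharp_polar hx hT hℓ hn hh hhT hH hu hS
  have hh0 : 0 < bandRadius n T := by linarith
  have hr0 : 0 < ‖u - ((x : ℂ) + (T : ℂ) * I)‖ := by linarith
  have hr28 : ‖u - ((x : ℂ) + (T : ℂ) * I)‖ ≤ 28 := by linarith
  have hξ := norm_xiSq_sq_arc_le_of_re_le (x' := x) (ρ := ‖u - ((x : ℂ) + (T : ℂ) * I)‖) (T := T)
    (δ := δ) (θ := θ) hx hr0 hr28 hT1200 hδ hδ1 hθ hleft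
  have hγ := norm_xiGammaFactor_line_le_saddle (δ := δ) hx hT hℓ hn hh hhT hH hu hS (by linarith) hδσ
  have hK := norm_sqKernel_le_of_mem_sphere hx hT hℓ hn hh hhT hH hu hS θ
  rw [arcIntegrandU, norm_mul, norm_mul, deriv_circleMap_eq_I_mul_sub, norm_mul, Complex.norm_I, one_mul,
    circleMap_sub_center, norm_circleMap_zero, abs_of_pos hr0, norm_arcModelIntegrand_eq,
    circleMap_norm_arg, abs_of_nonneg (norm_nonneg _)]
  have hrhi : ‖u - ((x : ℂ) + (T : ℂ) * I)‖ ≤ 34 / 25 * bandRadius n T := by linarith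
  generalize hh' : bandRadius n T = h at *
  generalize hXi : ‖xiSq (circleMap ((x : ℂ) + (T : ℂ) * I) ‖u - ((x : ℂ) + (T : ℂ) * I)‖ θ ^ 2)‖ = Xi at *
  generalize hKw : ‖sqKernel n ((x : ℂ) + (T : ℂ) * I)
    (circleMap ((x : ℂ) + (T : ℂ) * I) ‖u - ((x : ℂ) + (T : ℂ) * I)‖ θ)‖ = Kw at *
  generalize hG1 : ‖xiGammaFactor (((1 + δ : ℝ) : ℂ) + (T : ℂ) * I)‖ = G1 at *
  generalize hGs : ‖xiGammaFactor (1 / 2 + u)‖ = Gs at *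
  generalize hKu : ‖sqKernel n ((x : ℂ) + (T : ℂ) * I) u‖ = Ku at *
  generalize hE1 : Real.exp (-(((1 / 2 + u).re - (1 + δ)) * (ell T / 2 - 1))) = E1 at *
  generalize hr : ‖u - ((x : ℂ) + (T : ℂ) * I)‖ = r at *
  generalize hL : Real.log (T + r) = L at *
  have hXi0 : 0 ≤ Xi := by rw [← hXi]; exact norm_nonneg _
  have hKw0 : 0 ≤ Kw := by rw [← hKw]; exact norm_nonneg _
  have hG10 : 0 ≤ G1 := by rw [← hG1]; exact norm_nonneg _
  have hGs0 : 0 ≤ Gs := by rw [← hGs]; exact norm_nonneg _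
  have hKu0 : 0 ≤ Ku := by rw [← hKu]; exact norm_nonneg _
  have hE10 : 0 ≤ E1 := by rw [← hE1]; exact (Real.exp_pos _).le
  have hL0 : 0 ≤ L := by rw [← hL]; exact Real.log_nonneg (by linarith)
  -- `r·Xi·Kw ≤ r·[672 L e^{4r/5} G1]·[e^{h/4+1/20} Ku]`, `G1 ≤ e^{h/3} E1 Gs`
  have step1 : r * (Xi * Kw) ≤ r * ((672 * L * Real.exp (4 / 5 * r) * G1) * (Real.exp (h / 4 + 1 / 20) * Ku)) :=
    mul_le_mul_of_nonneg_left (mul_le_mul hξ hK hKw0 (by positivity)) hr0.le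
  have step2 : r * ((672 * L * Real.exp (4 / 5 * r) * G1) * (Real.exp (h / 4 + 1 / 20) * Ku)) ≤
      r * ((672 * L * Real.exp (4 / 5 * r) * (Real.exp (h / 3) * E1 * Gs)) * (Real.exp (h / 4 + 1 / 20) * Ku)) := by
    apply mul_le_mul_of_nonneg_left _ hr0.le
    apply mul_le_mul_of_nonneg_right _ (by positivity)
    exact mul_le_mul_of_nonneg_left hγ (by positivity)
  have step3 : r * ((672 * L * Real.exp (4 / 5 * r) * (Real.exp (h / 3) * E1 * Gs)) * (Real.exp (h / 4 + 1 / 20) * Ku)) =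
      672 * L * (Real.exp (4 / 5 * r) * Real.exp (h / 3) * Real.exp (h / 4 + 1 / 20)) * E1 * (r * (Gs * Ku)) := by
    ring
  have step4 : Real.exp (4 / 5 * r) * Real.exp (h / 3) * Real.exp (h / 4 + 1 / 20) ≤ Real.exp (2 * h + 1) := by
    rw [← Real.exp_add, ← Real.exp_add]
    exact Real.exp_le_exp.2 (by linarith)
  calc r * (Xi * Kw) ≤ _ := step1
    _ ≤ _ := step2
    _ = _ := step3
    _ ≤ 672 * L * Real.exp (2 * h + 1) * E1 * (r * (Gs * Ku)) := by
        apply mul_le_mul_of_nonneg_right _ (by positivity)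
        apply mul_le_mul_of_nonneg_right _ hE10
        exact mul_le_mul_of_nonneg_left step4 (by positivity)

end Summit.RiemannHypothesis.RiemannHypothesis.Theorems.JensenPolynomials.LogBandArc

end
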